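import Literature.NumberTheory.EllipticCurves.BSDSelmerSmithNormalisationProofs
import Literature.NumberTheory.EllipticCurves.RootNumberSmulProofs
import HarnessLib

/-!
# bsd.S34 (Smith, arXiv:2503.17619): Cor. 1.2, Cor. 1.3 and the parity input, printed forms

`BSDSelmerSmithNormalisationProofs` proves that the tree's density convention for quadratic twist
families (`twistDensity`: squarefree `d` ordered by `|d|`) and the convention printed in A. Smith,
*The Birch and Swinnerton-Dyer conjecture implies Goldfeld's conjecture*, arXiv:2503.17619, §1
(all `d ∈ ℤ^{≠0}` with `|d| ≤ H`, denominator `2H`) agree for every family of twists that is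
invariant under `d ↦ d m²` (`twistDensity_iff_tendsto_of_sq_invariant`), and applies this to the
`2^∞`-Selmer corank (Thm. 1.1, `smith_selmerCorank_density_iff_printed`). This file packages the
bridge for an arbitrary isomorphism-invariant property of the twist
(`twistDensity_iff_printed_of_invariant`) and applies it to the three other invariants of `E^d`
occurring in §1 of the paper, each an isomorphism invariant by a *proved* theorem of the tree —
the analytic rank (`WeierstrassCurve.analyticRank_smul`), the global root number
(`WeierstrassCurve.rootNumber_smul_holds`) and the Mordell–Weil rank
(`WeierstrassCurve.mordellWeilRank_variableChange_holds`):

* `goldfeld_printed_iff_twistDensity` — **Goldfeld's conjecture for `E` exactly as displayed in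
  §1** ("[Gold79]": `lim_{H → ∞} #{d ∈ ℤ^{≠0} : |d| ≤ H and r_an(E^d) = r} / 2H = 1/2` for
  `r = 0, 1` and `= 0` for `r ≥ 2`) is equivalent to its `twistDensity` form;
* `smith_goldfeld_printed_of_BSDRankFormula` — **Cor. 1.2 in the printed normalisation**: Thm. 1.1
  for `W` (the named fact `smith_selmerCorank_density W`, *not* proved in the tree), the rank
  part of BSD for every twist and display (1.2) in Monsky's form give Goldfeld's display
  verbatim (the deduction is `smith_analyticRank_density_of_BSDRankFormula` of
  `BSDSelmerSmithDensityProofs`);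
* `smith_rank_of_rootNumber_printed_of_facts` — **Cor. 1.3 in its printed, conditional form**
  ("among the quadratic twists `E^d` with `w(E^d) = +1`, `100 %` have rank `0`; among those with
  `w(E^d) = −1`, `100 %` have rank at most `1`"): the ratios
  `#{0 < |d| ≤ H : w(E^d) = +1, rank E^d(ℚ) = 0} / #{0 < |d| ≤ H : w(E^d) = +1}` and
  `#{0 < |d| ≤ H : w(E^d) = −1, rank E^d(ℚ) ≤ 1} / #{0 < |d| ≤ H : w(E^d) = −1}` tend to `1`, from
  Thm. 1.1 for `W` and `2`-parity for all elliptic curves over `ℚ` — the tree's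
  `smith_rank_of_rootNumber W` (`BSDSelmerSmithProofs`) states the two clauses as density-`1`
  implications over squarefree `d`, and the passage to the printed conditional densities uses
  that each sign of `w(E^d)` occurs with density `1/2` (`twistDensity_rootNumber_quadraticTwist_of`,
  itself from Thm. 1.1 and `2`-parity);
* `smith_selmerCorank_density_iff_le_one_and_rootNumber_printed` — the parity input of Thm. 1.1
  isolated in `smith_selmerCorank_density_iff_le_one_and_rootNumber` read in the printed
  normalisation.

Only theorems are added; no definition, no named fact, no statement of `BSDSelmer` is changed,
and nothing here proves Thm. 1.1.

## References

* [arXiv250317619] A. Smith, *The Birch and Swinnerton-Dyer conjecture implies Goldfeld's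
  conjecture*, arXiv:2503.17619 (2025): §1 — Goldfeld's Conjecture (display), Thm. 1.1,
  displays (1.1)–(1.2), Cor. 1.2 with its proof, Cor. 1.3.
* [Gold79] D. Goldfeld, *Conjectures on elliptic curves over quadratic fields*, Number theory,
  Carbondale 1979, LNM 751 (1979), 108–118 (as cited in arXiv:2503.17619).
* [DokchitserDokchitserAnnals2010] T. Dokchitser, V. Dokchitser, Ann. of Math. 172 (2010),
  Thm. 1.4 and §4.6 (case `p = 2`: Monsky 1996).
* [SilvermanAEC2009] J. H. Silverman, *The Arithmetic of Elliptic Curves*, 2nd ed., III.3.1(b),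
  App. C §16 with Prop. VII.1.3(b) (isomorphism invariance of `E(ℚ)`, of `L(E,s)` and of `w`).
-/

noncomputable section

open scoped Classical
open Filter Topology

namespace Literature.NumberTheory.EllipticCurves

variable (W : WeierstrassCurve ℚ)

/-! ### The bridge for an isomorphism-invariant property of the twist -/

/-- If a property `p` of Weierstrass curves takes the same value on the isomorphic twists
`E^{d e²}` and `E^d` (`d, e ≠ 0`), then the predicate "`d ≠ 0` and `p(E^d)`" on `ℤ` is invariant
under multiplication of `d` by nonzero squares. [folklore] -/
theorem ne_zero_and_sq_invariant {p : WeierstrassCurve ℚ → Prop}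
    (hp : ∀ d e : ℚ, d ≠ 0 → e ≠ 0 → (p (W.quadraticTwist (d * e ^ 2)) ↔ p (W.quadraticTwist d)))
    (d : ℤ) (m : ℕ) (hm : m ≠ 0) :
    (d * (m : ℤ) ^ 2 ≠ 0 ∧ p (W.quadraticTwist ((d * (m : ℤ) ^ 2 : ℤ) : ℚ))) ↔
      (d ≠ 0 ∧ p (W.quadraticTwist (d : ℚ))) := by
  by_cases hd : d = 0
  · simp [hd]
  · have hd' : (d : ℚ) ≠ 0 := by exact_mod_cast hd
    have hm' : (m : ℚ) ≠ 0 := by exact_mod_cast hm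
    have hm'' : ((m : ℤ) ^ 2 : ℤ) ≠ 0 := pow_ne_zero 2 (by exact_mod_cast hm)
    push_cast
    rw [hp _ _ hd' hm']
    exact and_congr (mul_ne_zero_iff.trans ⟨fun h ↦ h.1, fun h ↦ ⟨h, hm''⟩⟩) Iff.rfl

/-- **The two density conventions agree for every isomorphism-invariant property of the twist.**
If `p(E^{d e²}) ↔ p(E^d)` for `d, e ≠ 0`, then for every `δ` the squarefree `d` with `p(E^d)` have
`twistDensity` `δ` iff `#{d ∈ ℤ^{≠0} : |d| ≤ H, p(E^d)} / 2H → δ`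
(`twistDensity_iff_tendsto_of_sq_invariant` of `BSDSelmerSmithNormalisationProofs` applied to
`ne_zero_and_sq_invariant`). [folklore] -/
theorem twistDensity_iff_printed_of_invariant {p : WeierstrassCurve ℚ → Prop}
    (hp : ∀ d e : ℚ, d ≠ 0 → e ≠ 0 → (p (W.quadraticTwist (d * e ^ 2)) ↔ p (W.quadraticTwist d)))
    (δ : ℝ) :
    twistDensity (fun d ↦ d ≠ 0 ∧ p (W.quadraticTwist d)) δ ↔
      Tendsto (fun H : ℕ ↦ (Nat.card {d : ℤ | d ≠ 0 ∧ |d| ≤ (H : ℤ) ∧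
        p (W.quadraticTwist d)} : ℝ) / (2 * H)) atTop (𝓝 δ) := by
  rw [twistDensity_iff_tendsto_of_sq_invariant (ne_zero_and_sq_invariant W hp)]
  have hset : ∀ H : ℕ, {d : ℤ | d ≠ 0 ∧ |d| ≤ (H : ℤ) ∧ (d ≠ 0 ∧ p (W.quadraticTwist d))} =
      {d : ℤ | d ≠ 0 ∧ |d| ≤ (H : ℤ) ∧ p (W.quadraticTwist d)} := by
    intro H
    ext d
    simp only [Set.mem_setOf_eq]
    tauto
  simp only [hset]

/-- **Conditional densities in the printed normalisation.** If, among `d ∈ ℤ^{≠0}` with `|d| ≤ H`,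
both `#{Q ∧ P} / 2H` and `#{Q} / 2H` tend to the same `δ ≠ 0`, then
`#{0 < |d| ≤ H : Q d ∧ P d} / #{0 < |d| ≤ H : Q d} → 1` ("among the `d` with `Q`, `100 %` satisfy
`P`"). [folklore] -/
theorem tendsto_card_div_card_of_tendsto {P Q : ℤ → Prop} {δ : ℝ} (hδ : δ ≠ 0)
    (hQP : Tendsto (fun H : ℕ ↦ (Nat.card {d : ℤ | d ≠ 0 ∧ |d| ≤ (H : ℤ) ∧ (Q d ∧ P d)} : ℝ) /
      (2 * H)) atTop (𝓝 δ))
    (hQ : Tendsto (fun H : ℕ ↦ (Nat.card {d : ℤ | d ≠ 0 ∧ |d| ≤ (H : ℤ) ∧ Q d} : ℝ) / (2 * H))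
      atTop (𝓝 δ)) :
    Tendsto (fun H : ℕ ↦ (Nat.card {d : ℤ | d ≠ 0 ∧ |d| ≤ (H : ℤ) ∧ (Q d ∧ P d)} : ℝ) /
      Nat.card {d : ℤ | d ≠ 0 ∧ |d| ≤ (H : ℤ) ∧ Q d}) atTop (𝓝 1) := by
  have h := hQP.div hQ hδ
  rw [div_self hδ] at h
  refine h.congr' ?_
  filter_upwards [eventually_gt_atTop 0] with H hH
  have h2H : (2 * (H : ℝ)) ≠ 0 := by positivity
  simp only [Pi.div_apply]
  rw [div_div_div_cancel_right₀ h2H]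

/-! ### The analytic rank: Goldfeld's conjecture and Cor. 1.2 as printed -/

section AnalyticRank

variable [W.IsElliptic]

/-- **`r_an(E^{d e²}) = r_an(E^d)`** for an elliptic `W`, `d ≠ 0`, `e ≠ 0`: the two twists are
isomorphic over `ℚ` (`exists_variableChange_quadraticTwist_mul_sq`) and the analytic rank is an
isomorphism invariant of an elliptic curve (`WeierstrassCurve.analyticRank_smul`; Silverman,
*AEC*, App. C §16 with VII.1.3(b)). [cite: SilvermanAEC2009, App. C §16 with Prop. VII.1.3(b)] -/
theorem analyticRank_quadraticTwist_mul_sq {d : ℚ} (hd : d ≠ 0) (e : ℚ) (he : e ≠ 0) :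
    (W.quadraticTwist (d * e ^ 2)).analyticRank = (W.quadraticTwist d).analyticRank := by
  obtain ⟨C, hC⟩ := W.exists_variableChange_quadraticTwist_mul_sq d e he
  haveI := W.isElliptic_quadraticTwist hd
  rw [← hC, WeierstrassCurve.analyticRank_smul]

/-- **The two density conventions agree for the analytic rank of twists** (elliptic `W`, any `r`,
`δ`). [folklore] -/
theorem twistDensity_analyticRank_iff_printed (r : ℕ) (δ : ℝ) :
    twistDensity (fun d ↦ d ≠ 0 ∧ (W.quadraticTwist d).analyticRank = r) δ ↔
      Tendsto (fun H : ℕ ↦ (Nat.card {d : ℤ | d ≠ 0 ∧ |d| ≤ (H : ℤ) ∧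
        (W.quadraticTwist d).analyticRank = r} : ℝ) / (2 * H)) atTop (𝓝 δ) :=
  twistDensity_iff_printed_of_invariant W (p := fun E ↦ E.analyticRank = r)
    (fun _ e hd he ↦ by rw [analyticRank_quadraticTwist_mul_sq W hd e he]) δ

/-- **Goldfeld's conjecture for `E`, as displayed in Smith, arXiv:2503.17619, §1, versus its
`twistDensity` form.** For an elliptic `W`: "for every `r ≥ 0`,
`lim_{H → ∞} #{d ∈ ℤ^{≠0} : |d| ≤ H and r_an(E^d) = r} / 2H = 1/2` if `r = 0` or `r = 1`, and
`= 0` if `r ≥ 2`" holds iff, among squarefree `d` ordered by `|d|`, the twists with analytic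
rank `0` resp. `1` have density `1/2` each and those with analytic rank `r` have density `0` for
every `r ≥ 2`. [cite: arXiv250317619, §1 (Goldfeld's Conjecture, display)] -/
theorem goldfeld_printed_iff_twistDensity :
    (∀ r : ℕ, Tendsto (fun H : ℕ ↦ (Nat.card {d : ℤ | d ≠ 0 ∧ |d| ≤ (H : ℤ) ∧
        (W.quadraticTwist d).analyticRank = r} : ℝ) / (2 * H)) atTop
          (𝓝 (if r ≤ 1 then 1 / 2 else 0))) ↔
      twistDensity (fun d ↦ d ≠ 0 ∧ (W.quadraticTwist d).analyticRank = 0) (1 / 2) ∧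
        twistDensity (fun d ↦ d ≠ 0 ∧ (W.quadraticTwist d).analyticRank = 1) (1 / 2) ∧
          ∀ r : ℕ, 2 ≤ r →
            twistDensity (fun d ↦ d ≠ 0 ∧ (W.quadraticTwist d).analyticRank = r) 0 := by
  simp only [twistDensity_analyticRank_iff_printed]
  refine ⟨fun h ↦ ⟨by simpa using h 0, by simpa using h 1, fun r hr ↦ ?_⟩, fun h r ↦ ?_⟩
  · simpa [if_neg (show ¬ r ≤ 1 by omega)] using h r
  · obtain ⟨h0, h1, h2⟩ := h
    rcases Nat.lt_or_ge r 2 with hr | hr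
    · rw [if_pos (by omega)]
      interval_cases r
      · exact h0
      · exact h1
    · rw [if_neg (by omega)]
      exact h2 r hr

/-- **Smith, arXiv:2503.17619, Cor. 1.2, in the printed normalisation: "Given any elliptic curve
`E/ℚ`, if the BSD conjecture is true in the quadratic twist family of `E`, then Goldfeld's
conjecture holds for `E`."** For an elliptic `W`: if Thm. 1.1 holds for `W`
(`hS : smith_selmerCorank_density W`, the bsd.S34 named fact), the rank part of BSD
`r_an(E^d) = r_MW(E^d)` holds for every `d ≠ 0` (`hBSD`, `WeierstrassCurve.BSDRankFormula`), and
display (1.2) `r_{2^∞}(E') ≡ r_an(E') (mod 2)` holds for all elliptic `E'/ℚ` ("From [Monsky96]";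
`hMon : monsky_selmerCorank_two_mod_two_eq`), then for every `r ≥ 0`,
`lim_{H → ∞} #{d ∈ ℤ^{≠0} : |d| ≤ H and r_an(E^d) = r} / 2H = 1/2` if `r ≤ 1` and `= 0` if
`r ≥ 2` — Goldfeld's conjecture [Gold79] for `E` verbatim. The deduction is the printed one
(`smith_analyticRank_density_of_BSDRankFormula`, `BSDSelmerSmithDensityProofs`) followed by the
change of normalisation `goldfeld_printed_iff_twistDensity`.
[cite: arXiv250317619, Cor. 1.2] [cite: DokchitserDokchitserAnnals2010, §4.6, proof of Thm. 4.19 (case p = 2)] -/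
theorem smith_goldfeld_printed_of_BSDRankFormula (hS : smith_selmerCorank_density W)
    (hBSD : ∀ d : ℤ, d ≠ 0 → (W.quadraticTwist d).BSDRankFormula)
    (hMon : monsky_selmerCorank_two_mod_two_eq) (r : ℕ) :
    Tendsto (fun H : ℕ ↦ (Nat.card {d : ℤ | d ≠ 0 ∧ |d| ≤ (H : ℤ) ∧
        (W.quadraticTwist d).analyticRank = r} : ℝ) / (2 * H)) atTop
      (𝓝 (if r ≤ 1 then 1 / 2 else 0)) :=
  (goldfeld_printed_iff_twistDensity W).2
    (smith_analyticRank_density_of_BSDRankFormula W hS hBSD hMon) r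

end AnalyticRank

/-! ### The root number: the parity input as printed -/

section RootNumber

variable [W.IsElliptic]

/-- **`w(E^{d e²}) = w(E^d)`** for an elliptic `W`, `d ≠ 0`, `e ≠ 0`: the two twists are
isomorphic over `ℚ` (`exists_variableChange_quadraticTwist_mul_sq`) and the global root number
is an isomorphism invariant of an elliptic curve (`WeierstrassCurve.rootNumber_smul_holds`;
Silverman, *AEC*, App. C §16, Thm. 16.3 with VII.1.3(b)).
[cite: SilvermanAEC2009, App. C §16 Thm. 16.3 with Prop. VII.1.3(b)] -/
theorem rootNumber_quadraticTwist_mul_sq {d : ℚ} (hd : d ≠ 0) (e : ℚ) (he : e ≠ 0) :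
    (W.quadraticTwist (d * e ^ 2)).rootNumber = (W.quadraticTwist d).rootNumber := by
  obtain ⟨C, hC⟩ := W.exists_variableChange_quadraticTwist_mul_sq d e he
  haveI := W.isElliptic_quadraticTwist hd
  rw [← hC]
  exact WeierstrassCurve.rootNumber_smul_holds _ C

/-- **The two density conventions agree for the root number of twists** (elliptic `W`, any sign
`ε`, any `δ`). [folklore] -/
theorem twistDensity_rootNumber_iff_printed (ε : ℤ) (δ : ℝ) :
    twistDensity (fun d ↦ d ≠ 0 ∧ (W.quadraticTwist d).rootNumber = ε) δ ↔
      Tendsto (fun H : ℕ ↦ (Nat.card {d : ℤ | d ≠ 0 ∧ |d| ≤ (H : ℤ) ∧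
        (W.quadraticTwist d).rootNumber = ε} : ℝ) / (2 * H)) atTop (𝓝 δ) :=
  twistDensity_iff_printed_of_invariant W (p := fun E ↦ E.rootNumber = ε)
    (fun _ e hd he ↦ by rw [rootNumber_quadraticTwist_mul_sq W hd e he]) δ

/-- **Thm. 1.1 reduced to its inputs, root-number input in the printed normalisation.** For an
elliptic `W`, granted the `2`-parity theorem for all elliptic curves over `ℚ` (`hpar`, bsd.S19 at
`p = 2`; Dokchitser–Dokchitser 2010, Thm. 1.4 / Monsky 1996), `smith_selmerCorank_density W`
holds iff (a) `r_{2^∞}(E^d) ≤ 1` for a density-`1` set of squarefree `d` and (c) the root number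
is equidistributed in the sense `#{d ∈ ℤ^{≠0} : |d| ≤ H, w(E^d) = +1} / 2H → 1/2`
(`smith_selmerCorank_density_iff_le_one_and_rootNumber` of `BSDSelmerSmithDensityProofs` with
`twistDensity_rootNumber_iff_printed`). [cite: arXiv250317619, Thm. 1.1 and §1 display (1.2)] [cite: DokchitserDokchitserAnnals2010, Thm. 1.4] -/
theorem smith_selmerCorank_density_iff_le_one_and_rootNumber_printed
    (hpar : ∀ (E : WeierstrassCurve ℚ) [E.IsElliptic], p_parity E 2) :
    smith_selmerCorank_density W ↔
      twistDensity (fun d ↦ d ≠ 0 ∧ selmerCorankTwoInfty (W.quadraticTwist d) ≤ 1) 1 ∧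
        Tendsto (fun H : ℕ ↦ (Nat.card {d : ℤ | d ≠ 0 ∧ |d| ≤ (H : ℤ) ∧
          (W.quadraticTwist d).rootNumber = 1} : ℝ) / (2 * H)) atTop (𝓝 (1 / 2)) := by
  rw [smith_selmerCorank_density_iff_le_one_and_rootNumber W hpar,
    twistDensity_rootNumber_iff_printed]

/-- **Thm. 1.1 and (1.2) ⇒ each sign of `w(E^d)` for `50 %` of the twists, printed
normalisation**: for an elliptic `W`, granted `2`-parity for all elliptic curves over `ℚ`,
`smith_selmerCorank_density W` gives `#{d ∈ ℤ^{≠0} : |d| ≤ H, w(E^d) = ε} / 2H → 1/2` for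
`ε = +1` and for `ε = −1` (`twistDensity_rootNumber_quadraticTwist_of` and its complement,
`w ∈ {±1}`). [cite: arXiv250317619, Thm. 1.1 and §1 display (1.2)] [cite: DokchitserDokchitserAnnals2010, Thm. 1.4] -/
theorem tendsto_card_rootNumber_quadraticTwist_of
    (hpar : ∀ (E : WeierstrassCurve ℚ) [E.IsElliptic], p_parity E 2)
    (hS : smith_selmerCorank_density W) {ε : ℤ} (hε : ε = 1 ∨ ε = -1) :
    Tendsto (fun H : ℕ ↦ (Nat.card {d : ℤ | d ≠ 0 ∧ |d| ≤ (H : ℤ) ∧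
      (W.quadraticTwist d).rootNumber = ε} : ℝ) / (2 * H)) atTop (𝓝 (1 / 2)) := by
  rw [← twistDensity_rootNumber_iff_printed]
  have h1 := twistDensity_rootNumber_quadraticTwist_of W hpar hS
  rcases hε with rfl | rfl
  · exact h1
  · have hc := h1.compl
    rw [sub_half] at hc
    refine (twistDensity_congr (fun d hd ↦ ?_) _).1 hc
    have hd0 : d ≠ 0 := hd.ne_zero
    rcases (W.quadraticTwist (d : ℚ)).rootNumber_eq_one_or with h | h
    · simp [h, hd0]
    · simp [h, hd0]

end RootNumber

/-! ### Cor. 1.3 in its printed, conditional form -/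

section MordellWeilRank

/-- **`rank E^{d e²}(ℚ) = rank E^d(ℚ)`** (`e ≠ 0`): the two twists are isomorphic over `ℚ`
(`exists_variableChange_quadraticTwist_mul_sq`) and the Mordell–Weil rank is an isomorphism
invariant (`WeierstrassCurve.mordellWeilRank_variableChange_holds`; Silverman, *AEC*,
III.3.1(b)). [cite: SilvermanAEC2009, III.3.1(b)] -/
theorem mordellWeilRank_quadraticTwist_mul_sq (d e : ℚ) (he : e ≠ 0) :
    (W.quadraticTwist (d * e ^ 2)).mordellWeilRank = (W.quadraticTwist d).mordellWeilRank := by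
  obtain ⟨C, hC⟩ := W.exists_variableChange_quadraticTwist_mul_sq d e he
  rw [← hC]
  exact WeierstrassCurve.mordellWeilRank_variableChange_holds _ C

variable [W.IsElliptic]

/-- **Smith, arXiv:2503.17619, Cor. 1.3, printed (conditional-density) form, from Thm. 1.1 and
`2`-parity.** "Choose any elliptic curve `E/ℚ`. Then, among the quadratic twists `E^d` with
`w(E^d) = +1`, `100 %` have rank `0`. Further, among the quadratic twists with `w(E^d) = −1`,
`100 %` have rank at most `1`." For an elliptic `W`, granted Thm. 1.1 for `W`
(`hS : smith_selmerCorank_density W`) and `2`-parity for all elliptic curves over `ℚ` (`hpar`,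
display (1.2)): `#{0 < |d| ≤ H : w(E^d) = +1 and rank E^d(ℚ) = 0} / #{0 < |d| ≤ H : w(E^d) = +1} → 1`
and `#{0 < |d| ≤ H : w(E^d) = −1 and rank E^d(ℚ) ≤ 1} / #{0 < |d| ≤ H : w(E^d) = −1} → 1`.
Proof: the tree's form `smith_rank_of_rootNumber W` (density `1` of the two implications over
squarefree `d`; `smith_rank_of_rootNumber_of_facts`, `BSDSelmerSmithProofs`) intersected with the
density-`1/2` sets `{w(E^d) = ±1}` (`twistDensity_rootNumber_quadraticTwist_of`,
`twistDensity.and_one`) gives density `1/2` for `{w = +1, rank = 0}` and `{w = −1, rank ≤ 1}`;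
pass to the printed normalisation (`twistDensity_iff_printed_of_invariant`, the predicates being
isomorphism invariants of the twist) and divide (`tendsto_card_div_card_of_tendsto`).
[cite: arXiv250317619, Cor. 1.3] [cite: DokchitserDokchitserAnnals2010, Thm. 1.4] -/
theorem smith_rank_of_rootNumber_printed_of_facts (hS : smith_selmerCorank_density W)
    (hpar : ∀ (E : WeierstrassCurve ℚ) [E.IsElliptic], p_parity E 2) :
    Tendsto (fun H : ℕ ↦ (Nat.card {d : ℤ | d ≠ 0 ∧ |d| ≤ (H : ℤ) ∧
        ((W.quadraticTwist d).rootNumber = 1 ∧ (W.quadraticTwist d).mordellWeilRank = 0)} : ℝ) /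
          Nat.card {d : ℤ | d ≠ 0 ∧ |d| ≤ (H : ℤ) ∧ (W.quadraticTwist d).rootNumber = 1})
        atTop (𝓝 1) ∧
      Tendsto (fun H : ℕ ↦ (Nat.card {d : ℤ | d ≠ 0 ∧ |d| ≤ (H : ℤ) ∧
        ((W.quadraticTwist d).rootNumber = -1 ∧ (W.quadraticTwist d).mordellWeilRank ≤ 1)} : ℝ) /
          Nat.card {d : ℤ | d ≠ 0 ∧ |d| ≤ (H : ℤ) ∧ (W.quadraticTwist d).rootNumber = -1})
        atTop (𝓝 1) := by
  obtain ⟨hC0, hC1⟩ := smith_rank_of_rootNumber_of_facts W hS hpar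
  have hw : ∀ {ε : ℤ}, ε = 1 ∨ ε = -1 →
      twistDensity (fun d ↦ d ≠ 0 ∧ (W.quadraticTwist d).rootNumber = ε) (1 / 2) :=
    fun hε ↦ (twistDensity_rootNumber_iff_printed W _ _).2
      (tendsto_card_rootNumber_quadraticTwist_of W hpar hS hε)
  -- invariance of the two conjunctions under `d ↦ d e²`
  have hinv : ∀ (q : ℤ → ℕ → Prop) (d e : ℚ), d ≠ 0 → e ≠ 0 →
      ((fun E : WeierstrassCurve ℚ ↦ q E.rootNumber E.mordellWeilRank)
          (W.quadraticTwist (d * e ^ 2)) ↔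
        (fun E : WeierstrassCurve ℚ ↦ q E.rootNumber E.mordellWeilRank) (W.quadraticTwist d)) :=
    fun q d e hd he ↦ by
      simp only [rootNumber_quadraticTwist_mul_sq W hd e he,
        mordellWeilRank_quadraticTwist_mul_sq W d e he]
  constructor
  · have hA : twistDensity (fun d ↦ d ≠ 0 ∧ ((W.quadraticTwist d).rootNumber = 1 ∧
        (W.quadraticTwist d).mordellWeilRank = 0)) (1 / 2) := by
      refine (twistDensity_congr (fun d _ ↦ ?_) _).1 (twistDensity.and_one (hw (Or.inl rfl)) hC0)
      tauto
    exact tendsto_card_div_card_of_tendsto (by norm_num)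
      ((twistDensity_iff_printed_of_invariant W (p := fun E ↦ E.rootNumber = 1 ∧
        E.mordellWeilRank = 0) (hinv fun w r ↦ w = 1 ∧ r = 0) _).1 hA)
      ((twistDensity_rootNumber_iff_printed W 1 _).1 (hw (Or.inl rfl)))
  · have hA : twistDensity (fun d ↦ d ≠ 0 ∧ ((W.quadraticTwist d).rootNumber = -1 ∧
        (W.quadraticTwist d).mordellWeilRank ≤ 1)) (1 / 2) := by
      refine (twistDensity_congr (fun d _ ↦ ?_) _).1 (twistDensity.and_one (hw (Or.inr rfl)) hC1)
      tauto
    exact tendsto_card_div_card_of_tendsto (by norm_num)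
      ((twistDensity_iff_printed_of_invariant W (p := fun E ↦ E.rootNumber = -1 ∧
        E.mordellWeilRank ≤ 1) (hinv fun w r ↦ w = -1 ∧ r ≤ 1) _).1 hA)
      ((twistDensity_rootNumber_iff_printed W (-1) _).1 (hw (Or.inr rfl)))

end MordellWeilRank

end Literature.NumberTheory.EllipticCurves

end
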